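import Mathlib
import Summits.NavierStokesRegularity.NavierStokesRegularity.Theorems.TaoLadderRungTwoFlatCoMovingEnergyRate
import HarnessLib

/-!
# Tao ladder, rung 2♭ — DECAY of the co-moving deviation energy between edge crossings, and the crossing step
  (junk race L8b-1, part 3) (helper for item stmt-NavierStokesRegularity-22987 `FlatGapCertificatesV2`, crux K_A♭
  of route TaoLadderRungTwoFlat; cell harvest/h2-tao-ladder, p1 g21; LADDER §49.3)

* `le_exp_neg_mul_add_of_deriv_le` — scalar comparison: `V` continuous on `[t₁,t₂]`, `V' = D` on `(t₁,t₂)` with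
  `D ≤ −μV + Ē`, `μ > 0` ⇒ `V(t₂) ≤ e^{−μ(t₂−t₁)}V(t₁) + Ē(1 − e^{−μ(t₂−t₁)})/μ`;
* `continuousOn_coMovingEnergyOn` — continuity of `t ↦ V_{[a,P]}(t)` from continuity of the deviation;
* `coMovingEnergyOn_decay_Icc` — **L8b-1 between crossings**: along a template `W` and a deviation `u` with
  `u̇ = Q(W+u) − Q(W)` on the block `[a,P]` for `t ∈ (t₁,t₂)`, a-priori bounds `|u| ≤ A`, `|W| ≤ M` on shells
  `a−1 … P+1`, clocks `≤ c̄` on `a−1 … P`, edge input `≤ Ē`, and any `0 < μ ≤ σθ − 2(1+ε)c̄(A sinh(θ/2) + M(3+e^θ))`: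
  `V_{[a,P]}(t₂) ≤ e^{−μ(t₂−t₁)}·V_{[a,P]}(t₁) + Ē(1 − e^{−μ(t₂−t₁)})/μ` (edge `n_e(t) = n₀ + σt` throughout);
* `coMovingEnergyOn_insert`, `coMovingEnergyOn_Icc_succ`, `coMovingEnergyOn_Icc_succ_le` — the CROSSING STEP: when
  the edge passes shell `P+1` the block grows by one shell and `V` jumps by `φ_{P+1}·½|u_{P+1}|² ≤ ½|u_{P+1}|²`
  (`φ_{P+1} ≤ 1` while `P+1 ≤ n_e`).

Iterating (decay on `[t_j, t_{j+1}]`, jump at `t_{j+1}`) gives theory-1's (L8b-1):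
`V(t) ≤ e^{−μ(t−t₁)}V(t₁) + ∫ e^{−μ(t−s)}(E1+E2) + Σ_j e^{−μ(t−t_j)}E3(t_j)` in discrete form.

HONEST FRAMING: calculus inequalities about a MODEL lattice (Tao 2016 §4 vocabulary on `S♭`), kernel-checked; all
a-priori bounds are HYPOTHESES; nothing certified about any orbit; nothing about the Navier–Stokes equations.
-/

noncomputable section

-- the sub-problem namespace repeats the summit name by design (D-0017)
set_option linter.dupNamespace false

namespace Summit.NavierStokesRegularity.NavierStokesRegularity.Theorems

open Set Filter Literature.Analysis.FluidPDE Literature.Analysis.FluidPDE.TaoCascade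
open scoped Topology

namespace MirrorPulse

/-! ### 1. Scalar comparison lemma -/

/-- **Linear decay with forcing.** If `V` is continuous on `[t₁,t₂]`, has derivative `D t` at every interior point,
and `D t ≤ −μ·V t + Ē` there with `μ > 0`, then `V(t₂) ≤ e^{−μ(t₂−t₁)}·V(t₁) + Ē·(1 − e^{−μ(t₂−t₁)})/μ`. [folklore] -/
theorem le_exp_neg_mul_add_of_deriv_le {V D : ℝ → ℝ} {t₁ t₂ μ Ebar : ℝ} (ht : t₁ ≤ t₂) (hμ : 0 < μ)
    (hVc : ContinuousOn V (Icc t₁ t₂)) (hVd : ∀ t ∈ Ioo t₁ t₂, HasDerivAt V (D t) t)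
    (hD : ∀ t ∈ Ioo t₁ t₂, D t ≤ -μ * V t + Ebar) :
    V t₂ ≤ Real.exp (-μ * (t₂ - t₁)) * V t₁ + Ebar * (1 - Real.exp (-μ * (t₂ - t₁))) / μ := by
  -- the gauge e^{μ(t−t₁)} and the comparison function H
  have hexp : ∀ t, HasDerivAt (fun s => Real.exp (μ * (s - t₁))) (Real.exp (μ * (t - t₁)) * μ) t := by
    intro t
    have h := (((hasDerivAt_id t).sub_const t₁).const_mul μ).exp
    simpa using h
  set H : ℝ → ℝ := fun s => Real.exp (μ * (s - t₁)) * V s - Ebar * (Real.exp (μ * (s - t₁)) - 1) / μ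
    with hH_def
  have hec : Continuous fun s => Real.exp (μ * (s - t₁)) := by fun_prop
  have hHc : ContinuousOn H (Icc t₁ t₂) := by
    refine ContinuousOn.sub (hec.continuousOn.mul hVc) (Continuous.continuousOn ?_)
    fun_prop
  have hHd : ∀ t ∈ Ioo t₁ t₂, HasDerivAt H
      (Real.exp (μ * (t - t₁)) * μ * V t + Real.exp (μ * (t - t₁)) * D t
        - Ebar * (Real.exp (μ * (t - t₁)) * μ) / μ) t := by
    intro t ht'
    have h1 := (hexp t).mul (hVd t ht')
    have h2 := (((hexp t).sub_const 1).const_mul Ebar).div_const μ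
    exact h1.sub h2
  have hHd' : ∀ t ∈ interior (Icc t₁ t₂), deriv H t ≤ 0 := by
    intro t ht'
    rw [interior_Icc] at ht'
    rw [(hHd t ht').deriv]
    have hpos : 0 < Real.exp (μ * (t - t₁)) := Real.exp_pos _
    have hd := hD t ht'
    have : Ebar * (Real.exp (μ * (t - t₁)) * μ) / μ = Ebar * Real.exp (μ * (t - t₁)) := by
      field_simp
    rw [this]
    nlinarith [mul_le_mul_of_nonneg_left hd hpos.le]
  have hanti : AntitoneOn H (Icc t₁ t₂) :=
    antitoneOn_of_deriv_nonpos (convex_Icc _ _) hHc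
      (fun t ht' => by
        rw [interior_Icc] at ht'
        exact (hHd t ht').differentiableAt.differentiableWithinAt)
      hHd'
  have hH := hanti (left_mem_Icc.mpr ht) (right_mem_Icc.mpr ht) ht
  -- unpack H t₂ ≤ H t₁ = V t₁
  have hH1 : H t₁ = V t₁ := by simp [hH_def]
  rw [hH1] at hH
  simp only [hH_def] at hH
  set E : ℝ := Real.exp (μ * (t₂ - t₁)) with hE_def
  have hEpos : 0 < E := Real.exp_pos _
  have hEinv : Real.exp (-μ * (t₂ - t₁)) = E⁻¹ := by
    rw [hE_def, ← Real.exp_neg]; congr 1; ring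
  rw [hEinv]
  -- from  E·V t₂ − Ē(E−1)/μ ≤ V t₁  to the claim
  have key : V t₂ = E⁻¹ * (E * V t₂) := by
    rw [← mul_assoc, inv_mul_cancel₀ hEpos.ne', one_mul]
  have h2 : E⁻¹ * (E * V t₂) ≤ E⁻¹ * (V t₁ + Ebar * (E - 1) / μ) :=
    mul_le_mul_of_nonneg_left (by linarith) (inv_nonneg.mpr hEpos.le)
  have h3 : E⁻¹ * (V t₁ + Ebar * (E - 1) / μ) = E⁻¹ * V t₁ + Ebar * (1 - E⁻¹) / μ := by
    field_simp
  linarith [key, h2, h3]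

/-! ### 2. Continuity of the block energy -/

/-- The co-moving block energy is continuous in time on `[t₁,t₂]` when the deviation is (block shells only).
[cite: Tao2016AveragedNS, §4 (4.3); route TaoLadderRungTwoFlat, L8b-1] -/
theorem continuousOn_coMovingEnergyOn {θ σ n₀ t₁ t₂ : ℝ} (s : Finset ℤ) {u : Fin 2 → ℤ → ℝ → ℝ}
    (hcont : ∀ i, ∀ n ∈ s, ContinuousOn (u i n) (Icc t₁ t₂)) :
    ContinuousOn (fun t => coMovingEnergyOn s θ (n₀ + σ * t) u t) (Icc t₁ t₂) := by
  simp only [coMovingEnergyOn]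
  refine continuousOn_finsetSum s fun n hn => ?_
  refine ContinuousOn.mul (Continuous.continuousOn (by fun_prop)) ?_
  exact (((hcont 0 n hn).pow 2).add ((hcont 1 n hn).pow 2)).div_const 2

/-! ### 3. Decay between crossings -/

/-- **L8b-1 BETWEEN EDGE CROSSINGS.** Template `W`, deviation `u` with `u̇ = Q(W+u) − Q(W)` on the block `[a,P]`
for `t ∈ (t₁,t₂)`, `u` continuous on `[t₁,t₂]` there; a-priori bounds on `(t₁,t₂)`: `|u| ≤ A` and `|W| ≤ M` on shells
`a−1 … P+1`, clocks `≤ c̄` on `a−1 … P`, and the edge input (bottom bond, top bond, two boundary monomials) `≤ Ē`;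
a rate `0 < μ ≤ σθ − 2(1+ε)c̄(A sinh(θ/2) + M(3+e^θ))`. Then, with the edge at `n_e(t) = n₀ + σt`,
`V_{[a,P]}(t₂) ≤ e^{−μ(t₂−t₁)}·V_{[a,P]}(t₁) + Ē·(1 − e^{−μ(t₂−t₁)})/μ`.
[cite: Tao2016AveragedNS, §4 (4.3), (4.8), §5–§6; route TaoLadderRungTwoFlat, L8b-1 (LADDER §49.3)] -/
theorem coMovingEnergyOn_decay_Icc {ε ε₀ θ σ n₀ A M cbar μ Ebar t₁ t₂ : ℝ} (hε : 0 ≤ ε) (hε₀ : -1 ≤ ε₀)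
    (hθ : 0 ≤ θ) {a P : ℤ} (haP : a ≤ P) (ht : t₁ ≤ t₂) {W u : Fin 2 → ℤ → ℝ → ℝ}
    (hcont : ∀ i, ∀ n ∈ Finset.Icc a P, ContinuousOn (u i n) (Icc t₁ t₂))
    (hder : ∀ t ∈ Ioo t₁ t₂, ∀ i, ∀ n ∈ Finset.Icc a P,
      HasDerivAt (u i n) (quadTermOn shiftSetFlat ε₀ (mirrorTable ε ε) (W + u) i n t
        - quadTermOn shiftSetFlat ε₀ (mirrorTable ε ε) W i n t) t)
    (hA : ∀ t ∈ Ioo t₁ t₂, ∀ i, ∀ n ∈ Finset.Icc (a - 1) (P + 1), |u i n t| ≤ A)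
    (hM : ∀ t ∈ Ioo t₁ t₂, ∀ i, ∀ n ∈ Finset.Icc (a - 1) (P + 1), |W i n t| ≤ M)
    (hc : ∀ n ∈ Finset.Icc (a - 1) P, clock ε₀ n ≤ cbar)
    (hE : ∀ t ∈ Ioo t₁ t₂,
      Real.exp (θ * ((a : ℝ) - (n₀ + σ * t))) * |fluxT ε ε₀ u (a - 1) t|
        + Real.exp (θ * ((P : ℝ) - (n₀ + σ * t))) * |fluxT ε ε₀ u P t|
        + (1 + ε) * cbar * M * (Real.exp (θ * ((a : ℝ) - (n₀ + σ * t))) * u 1 (a - 1) t ^ 2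
            + Real.exp (θ * ((P : ℝ) - (n₀ + σ * t))) * u 0 (P + 1) t ^ 2) ≤ Ebar)
    (hμ : 0 < μ) (hμle : μ ≤ σ * θ - 2 * (1 + ε) * cbar * (A * Real.sinh (θ / 2) + M * (3 + Real.exp θ))) :
    coMovingEnergyOn (Finset.Icc a P) θ (n₀ + σ * t₂) u t₂
      ≤ Real.exp (-μ * (t₂ - t₁)) * coMovingEnergyOn (Finset.Icc a P) θ (n₀ + σ * t₁) u t₁
        + Ebar * (1 - Real.exp (-μ * (t₂ - t₁))) / μ := by
  refine le_exp_neg_mul_add_of_deriv_le (V := fun t => coMovingEnergyOn (Finset.Icc a P) θ (n₀ + σ * t) u t)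
    ht hμ (continuousOn_coMovingEnergyOn (Finset.Icc a P) hcont)
    (fun t ht' => hasDerivAt_coMovingEnergyOn (Finset.Icc a P) (hder t ht')) ?_
  intro t ht'
  have hsrc := weightedSource_le hε hε₀ hθ haP W u t (n₀ + σ * t) (hA t ht') (hM t ht') hc
  have hV0 := coMovingEnergyOn_nonneg (Finset.Icc a P) θ (n₀ + σ * t) u t
  have hEt := hE t ht'
  have hrate : (σ * θ - μ) * coMovingEnergyOn (Finset.Icc a P) θ (n₀ + σ * t) u t
      ≥ 2 * (1 + ε) * cbar * (A * Real.sinh (θ / 2) + M * (3 + Real.exp θ))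
          * coMovingEnergyOn (Finset.Icc a P) θ (n₀ + σ * t) u t :=
    mul_le_mul_of_nonneg_right (by linarith) hV0
  linarith

/-! ### 4. The crossing step -/

/-- Adding one shell to the block adds its weighted site energy.
[cite: Tao2016AveragedNS, §4 (4.3); route TaoLadderRungTwoFlat, L8b-1 (LADDER §49.3, E3)] -/
theorem coMovingEnergyOn_insert {s : Finset ℤ} {m : ℤ} (hm : m ∉ s) (θ ne : ℝ) (u : Fin 2 → ℤ → ℝ → ℝ)
    (t : ℝ) :
    coMovingEnergyOn (insert m s) θ ne u t
      = coMovingEnergyOn s θ ne u t + Real.exp (θ * ((m : ℝ) - ne)) * ((u 0 m t ^ 2 + u 1 m t ^ 2) / 2) := by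
  unfold coMovingEnergyOn
  rw [Finset.sum_insert hm, add_comm]

/-- **Crossing step, exact**: `V_{[a,P+1]} = V_{[a,P]} + φ_{P+1}·½|u_{P+1}|²` (`a ≤ P + 1`).
[cite: Tao2016AveragedNS, §4 (4.3); route TaoLadderRungTwoFlat, L8b-1 (LADDER §49.3, E3)] -/
theorem coMovingEnergyOn_Icc_succ {a P : ℤ} (haP : a ≤ P + 1) (θ ne : ℝ) (u : Fin 2 → ℤ → ℝ → ℝ) (t : ℝ) :
    coMovingEnergyOn (Finset.Icc a (P + 1)) θ ne u t
      = coMovingEnergyOn (Finset.Icc a P) θ ne u t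
        + Real.exp (θ * (((P + 1 : ℤ) : ℝ) - ne)) * ((u 0 (P + 1) t ^ 2 + u 1 (P + 1) t ^ 2) / 2) := by
  rw [← Finset.insert_Icc_right_eq_Icc_add_one haP, coMovingEnergyOn_insert (by simp)]

/-- **Crossing step, bound**: while shell `P+1` is at or below the edge (`P + 1 ≤ n_e`, `θ ≥ 0`) its weight is
`≤ 1`, so `V_{[a,P+1]} ≤ V_{[a,P]} + ½|u_{P+1}|²` — the jump `E3` of theory-1's (L8b-1).
[cite: Tao2016AveragedNS, §4 (4.3); route TaoLadderRungTwoFlat, L8b-1 (LADDER §49.3, E3)] -/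
theorem coMovingEnergyOn_Icc_succ_le {a P : ℤ} (haP : a ≤ P + 1) {θ ne : ℝ} (hθ : 0 ≤ θ)
    (hne : ((P + 1 : ℤ) : ℝ) ≤ ne) (u : Fin 2 → ℤ → ℝ → ℝ) (t : ℝ) :
    coMovingEnergyOn (Finset.Icc a (P + 1)) θ ne u t
      ≤ coMovingEnergyOn (Finset.Icc a P) θ ne u t + (u 0 (P + 1) t ^ 2 + u 1 (P + 1) t ^ 2) / 2 := by
  rw [coMovingEnergyOn_Icc_succ haP]
  have hw : Real.exp (θ * (((P + 1 : ℤ) : ℝ) - ne)) ≤ 1 := by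
    rw [Real.exp_le_one_iff]
    exact mul_nonpos_of_nonneg_of_nonpos hθ (by linarith)
  have he : 0 ≤ (u 0 (P + 1) t ^ 2 + u 1 (P + 1) t ^ 2) / 2 := by positivity
  nlinarith

/-- The block energy is monotone in the block. [cite: Tao2016AveragedNS, §4 (4.3); route TaoLadderRungTwoFlat, L8b-1] -/
theorem coMovingEnergyOn_mono {s s' : Finset ℤ} (h : s ⊆ s') (θ ne : ℝ) (u : Fin 2 → ℤ → ℝ → ℝ) (t : ℝ) :
    coMovingEnergyOn s θ ne u t ≤ coMovingEnergyOn s' θ ne u t := by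
  unfold coMovingEnergyOn
  exact Finset.sum_le_sum_of_subset_of_nonneg h fun n _ _ => by positivity

/-- Re-basing the edge: `V` with edge `ne'` is `e^{θ(ne − ne')}` times `V` with edge `ne` (used to restart the
clock `n_e(t) = n₀ + σt` at a crossing). [cite: Tao2016AveragedNS, §4 (4.3); route TaoLadderRungTwoFlat, L8b-1] -/
theorem coMovingEnergyOn_rebase (s : Finset ℤ) (θ ne ne' : ℝ) (u : Fin 2 → ℤ → ℝ → ℝ) (t : ℝ) :
    coMovingEnergyOn s θ ne' u t = Real.exp (θ * (ne - ne')) * coMovingEnergyOn s θ ne u t := by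
  unfold coMovingEnergyOn
  rw [Finset.mul_sum]
  refine Finset.sum_congr rfl fun n _ => ?_
  rw [← mul_assoc, ← Real.exp_add]
  congr 2
  ring

end MirrorPulse

end Summit.NavierStokesRegularity.NavierStokesRegularity.Theorems

end
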